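import Literature.Probability.RandomPlanarGeometry.PlusHullCapacity
import Literature.Probability.RandomPlanarGeometry.SlitHulls
import Literature.Analysis.Complex.LengthAreaEnclosure
import HarnessLib

/-!
# The maps `g_t` of a growing slit: tip values and their continuity (Lawler (2005), Lemmas 4.1–4.2)

G. F. Lawler, *Conformally Invariant Processes in the Plane*, AMS (2005), §4.1, for a simple
curve `γ` with `γ(0) ∈ ℝ`, `γ(0, t] ⊆ ℍ`, `H_t = ℍ ∖ γ[0, t]`, `g_t = g_{γ(0,t]}`:

* Lemma 4.1: "`diam[g_s(γ(s, t])] ≤ c √(diam(γ[0,t₀]) osc(γ, t - s, t₀))`,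
  `‖g_s - g_t‖_∞ ≤ c √(…)`";
* Lemma 4.2: "for every `t`, there is a unique `U_t ∈ ℝ` with `g_t(γ(t)) = U_t` in the sense
  `lim_{z → γ(t)} g_t(z) = U_t` … and `t ↦ U_t` is continuous";
* Remark 4.5: `b(t) = hcap[γ(0, t]]` is continuous and strictly increasing.

Lawler proves Lemma 4.1 with the Beurling estimate (Prop. 3.82, Brownian motion). Here the
moduli of continuity come from the length–area lemma
(`Literature.Analysis.Complex.LengthArea.norm_sub_le_of_isPreconnected`, `LengthAreaDiameter`)
and the function-theoretic hull theory of `HydrodynamicMaps` / `PlusHullCapacity`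
(`|g - id| ≤ 580 rad`, `hcap ≤ 288 rad²`, quotient maps `g_{s,t} = g_t ∘ g_s⁻¹` and the
additivity of `hcap`). This is the first half of the tree's proof of **Loewner's slit theorem**
in the form `Literature.Probability.RandomPlanarGeometry.IsArcHull.exists_loewner_chain`
(`RestrictionDensityLoewner`; [LSW] proof of Lemma 3.5, p. 13: "By the chordal version of
Loewner's theorem …"), for the boundary path `γ : [0, 1] → ℍ̄` of an arc hull `A ∈ 𝒬₊`
(`Literature.Probability.RandomPlanarGeometry.SlitArcData`). Main results, all uniform in the time parameter:

* `SlitArcData.slitMap` — the maps `g_u : ℍ ∖ γ[0, u] → ℍ` (`0 < u < 1`);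
* `SlitArcData.tip_cauchy` — **Cauchy estimate at the tip**: `g_u(z₁) - g_u(z₂)` is small for
  `z₁, z₂ ∈ H_u` near `γ(u)`, uniformly in `u` (the straight segment from `z_i` to `γ(u)` first
  meets `γ[0, u]` at `γ(u'_i)` with `u - u'_i` small; the segment followed by `γ[u'_i, u]` is a
  small connected subset of `H_{u''}`, `u'' < u'_i`, so length–area applies to `g_{u''}`, and
  `g_u = g_{u'',u} ∘ g_{u''}` with `g_{u'',u}` close to the identity);
* `SlitArcData.tipVal`, `SlitArcData.tendsto_slitMap_tip` — **`U_u = lim_{z → γ(u)} g_u(z)`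
  exists** and is real (Lemma 4.2), with the uniform bound `norm_slitMap_sub_tipVal_le`;
* `SlitArcData.diffImage_subset_closedBall` — local growth: `g_u(γ(u, u'])` lies in a small
  disc about `U_u` for `u' - u` small (Lemma 4.1, first assertion);
* `SlitArcData.norm_slitMap_sub_slitMap_le` — `‖g_{u'} - g_u‖_∞` small (Lemma 4.1, second
  assertion); `SlitArcData.abs_tipVal_sub_tipVal_le` — **`u ↦ U_u` is uniformly continuous**;
  `SlitArcData.abs_hcap_sub_hcap_le`, `hcap_slit_lt_hcap_slit` — **`b` is uniformly continuous
  and strictly increasing** (Remark 4.5); `tipVal`/`hcap` tend to `γ(0)`/`0` as `u → 0`.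

## References

* G. F. Lawler, *Conformally Invariant Processes in the Plane* (2005), §4.1, Lemmas 4.1, 4.2,
  Remark 4.5. [Lawler2005]
* G. F. Lawler, O. Schramm, W. Werner, *Conformal restriction: the chordal case* (2003), proof
  of Lemma 3.5, p. 13. [LawlerSchrammWerner2003Restriction]
-/

noncomputable section

open Set Filter Topology Metric Bornology Complex
open UpperHalfPlane (upperHalfPlaneSet isOpen_upperHalfPlaneSet)
open Literature.Analysis.Complex
open scoped Real

namespace Literature.Probability.RandomPlanarGeometry

/-! ### Slits -/

/-- The slit `γ[0, u]`. [folklore] -/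
def slit (γ : ℝ → ℂ) (u : ℝ) : Set ℂ := γ '' Icc 0 u

/-- Slits increase. [folklore] -/
theorem slit_mono (γ : ℝ → ℂ) {u u' : ℝ} (h : u ≤ u') : slit γ u ⊆ slit γ u' :=
  image_mono (Icc_subset_Icc_right h)

/-- **The data of Loewner's slit theorem for an arc hull**: `A ∈ 𝒬₊` whose boundary in `ℍ` is
the simple path `γ : [0, 1] → ℍ̄` with real endpoints (the hypotheses of
`IsArcHull.exists_loewner_chain`; [LSW] p. 13: "∂`E_δ ∩ ℍ̄` is a simple path `β : [0, s] → ℍ̄`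
with `β(0), β(s) ∈ ℝ`"). [cite: LawlerSchrammWerner2003Restriction, proof of Lemma 3.5 (p. 13)] -/
structure SlitArcData (A : Set ℂ) (γ : ℝ → ℂ) : Prop where
  isPlusHull : IsPlusHull A
  continuousOn : ContinuousOn γ (Icc 0 1)
  injOn : InjOn γ (Icc 0 1)
  im_zero : (γ 0).im = 0
  im_one : (γ 1).im = 0
  im_pos : ∀ t ∈ Ioo (0 : ℝ) 1, 0 < (γ t).im
  frontier_eq : upperHalfPlaneSet ∩ frontier A = γ '' Ioo 0 1

namespace SlitArcData

variable {A : Set ℂ} {γ : ℝ → ℂ}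

/-! #### Elementary consequences -/

/-- `A` is closed. [folklore] -/
theorem isClosed (h : SlitArcData A γ) : IsClosed A := h.isPlusHull.1.isBoundedHull.isClosed

/-- `A` is compact. [folklore] -/
theorem isCompact (h : SlitArcData A γ) : IsCompact A := h.isPlusHull.1.isBoundedHull.isCompact

/-- The open arc `γ(0, 1)` lies in `A`. [folklore] -/
theorem image_Ioo_subset (h : SlitArcData A γ) : γ '' Ioo 0 1 ⊆ A := fun z hz ↦ by
  have : z ∈ upperHalfPlaneSet ∩ frontier A := h.frontier_eq ▸ hz
  exact h.isClosed.frontier_subset this.2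

/-- The whole path `γ[0, 1]` lies in `A`. [folklore] -/
theorem apply_mem (h : SlitArcData A γ) {t : ℝ} (ht : t ∈ Icc (0 : ℝ) 1) : γ t ∈ A := by
  have h1 : γ '' closure (Ioo (0 : ℝ) 1) ⊆ closure (γ '' Ioo 0 1) :=
    (h.continuousOn.mono (by rw [closure_Ioo zero_ne_one])).image_closure
  rw [closure_Ioo zero_ne_one] at h1
  exact h.isClosed.closure_subset_iff.2 h.image_Ioo_subset (h1 ⟨t, ht, rfl⟩)

/-- `A` is nonempty. [folklore] -/
theorem nonempty (h : SlitArcData A γ) : A.Nonempty := ⟨γ 0, h.apply_mem ⟨le_rfl, zero_le_one⟩⟩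

/-- `γ(0)` is the real number `re γ(0)`. [folklore] -/
theorem apply_zero_eq (h : SlitArcData A γ) : γ 0 = (((γ 0).re : ℝ) : ℂ) :=
  Complex.ext (by simp) (by simp [h.im_zero])

/-- `re γ(0) > 0` (`A ∈ 𝒬₊`). [folklore] -/
theorem re_zero_pos (h : SlitArcData A γ) : 0 < (γ 0).re :=
  h.isPlusHull.2 _ (h.apply_zero_eq ▸ h.apply_mem ⟨le_rfl, zero_le_one⟩)

/-- Points `γ(t)`, `0 < t < 1`, are in `ℍ`; in particular `γ(t) ≠ γ(0)`. [folklore] -/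
theorem im_pos_of_mem {t : ℝ} (h : SlitArcData A γ) (ht : t ∈ Ioo (0 : ℝ) 1) : 0 < (γ t).im :=
  h.im_pos t ht

/-- The slit `γ[0, u]` (`u < 1`) lies in `A`. [folklore] -/
theorem slit_subset (h : SlitArcData A γ) {u : ℝ} (hu : u < 1) : slit γ u ⊆ A := by
  rintro _ ⟨t, ht, rfl⟩
  exact h.apply_mem ⟨ht.1, ht.2.trans hu.le⟩

/-- **The slits are nonempty `+`-hulls** (`SlitHulls`). [cite: Lawler2005, §4.1 (H_t simply connected)] -/
theorem isPlusHull_slit (h : SlitArcData A γ) {u : ℝ} (hu : u ∈ Ioo (0 : ℝ) 1) : IsPlusHull (slit γ u) :=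
  RandomPlanarGeometry.isPlusHull_slit hu.1 (h.continuousOn.mono (Icc_subset_Icc_right hu.2.le))
    (h.injOn.mono (Icc_subset_Icc_right hu.2.le)) h.im_zero h.re_zero_pos
    fun t ht ↦ h.im_pos t ⟨ht.1, ht.2.trans_lt hu.2⟩

/-- The slits are nonempty. [folklore] -/
theorem slit_nonempty (γ : ℝ → ℂ) {u : ℝ} (hu : 0 ≤ u) : (slit γ u).Nonempty :=
  ⟨γ 0, 0, ⟨le_rfl, hu⟩, rfl⟩

/-- The points of `ℍ` on the slit `γ[0, u]` off the slit `γ[0, u']` (`u' ≤ u < 1`) are the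
`γ(t)`, `u' < t ≤ u`. [folklore] -/
theorem diff_inter_slit_eq (h : SlitArcData A γ) {u' u : ℝ} (hu' : 0 ≤ u') (hu'u : u' ≤ u) (hu : u < 1) :
    (upperHalfPlaneSet \ slit γ u') ∩ slit γ u = γ '' Ioc u' u := by
  ext z
  constructor
  · rintro ⟨⟨hzH, hz'⟩, ⟨t, ht, rfl⟩⟩
    refine ⟨t, ⟨?_, ht.2⟩, rfl⟩
    by_contra hlt
    exact hz' ⟨t, ⟨ht.1, not_lt.1 hlt⟩, rfl⟩
  · rintro ⟨t, ht, rfl⟩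
    have ht1 : t ∈ Icc (0 : ℝ) 1 := ⟨hu'.trans ht.1.le, (ht.2.trans_lt hu).le⟩
    refine ⟨⟨h.im_pos t ⟨hu'.trans_lt ht.1, ht.2.trans_lt hu⟩, ?_⟩, ⟨t, ⟨hu'.trans ht.1.le, ht.2⟩, rfl⟩⟩
    rintro ⟨s, hs, hst⟩
    have := h.injOn ⟨hs.1, hs.2.trans (hu'u.trans hu.le)⟩ ht1 hst
    rw [this] at hs
    linarith [hs.2, ht.1]

/-- `γ(t) ∈ ℍ ∖ γ[0, u]` for `u < t < 1`. [folklore] -/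
theorem apply_mem_diff_slit (h : SlitArcData A γ) {u t : ℝ} (hu : 0 ≤ u) (hut : u < t) (ht : t < 1) :
    γ t ∈ upperHalfPlaneSet \ slit γ u := by
  have := (h.diff_inter_slit_eq hu hut.le ht).symm.subset ⟨t, ⟨hut, le_rfl⟩, rfl⟩
  exact this.1

/-- `ℍ ∖ A ⊆ ℍ ∖ γ[0, u]`. [folklore] -/
theorem diff_subset_diff_slit (h : SlitArcData A γ) {u : ℝ} (hu : u < 1) :
    upperHalfPlaneSet \ A ⊆ upperHalfPlaneSet \ slit γ u :=
  fun _ hz ↦ ⟨hz.1, fun hzT ↦ hz.2 (h.slit_subset hu hzT)⟩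

/-! #### A common radius -/

/-- A radius `R > 0` with `A ⊆ B̄(γ(0), R)` (hence all slits too). [folklore] -/
def radius (A : Set ℂ) (γ : ℝ → ℂ) : ℝ :=
  sSup ((fun z ↦ ‖z - γ 0‖) '' A) + 1

/-- `‖z - γ(0)‖ ≤ R - 1` on `A`. [folklore] -/
theorem norm_sub_le_radius (h : SlitArcData A γ) {z : ℂ} (hz : z ∈ A) : ‖z - γ 0‖ ≤ radius A γ - 1 := by
  have hb : BddAbove ((fun z ↦ ‖z - γ 0‖) '' A) :=
    (h.isCompact.image (continuous_norm.comp (continuous_id.sub continuous_const))).bddAbove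
  have := le_csSup hb ⟨z, hz, rfl⟩
  rw [radius]; linarith

/-- `R > 0`. [folklore] -/
theorem radius_pos (h : SlitArcData A γ) : 0 < radius A γ := by
  have := h.norm_sub_le_radius (h.apply_mem ⟨le_rfl, zero_le_one⟩)
  linarith [norm_nonneg (γ 0 - γ 0)]

/-- `A ⊆ B̄(re γ(0), R)`. [folklore] -/
theorem subset_closedBall (h : SlitArcData A γ) : A ⊆ closedBall (((γ 0).re : ℝ) : ℂ) (radius A γ) := fun z hz ↦ by
  rw [mem_closedBall, dist_eq_norm, ← h.apply_zero_eq]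
  linarith [h.norm_sub_le_radius hz]

/-- `γ[0, u] ⊆ B̄(re γ(0), R)` for `u < 1`. [folklore] -/
theorem slit_subset_closedBall (h : SlitArcData A γ) {u : ℝ} (hu : u < 1) :
    slit γ u ⊆ closedBall (((γ 0).re : ℝ) : ℂ) (radius A γ) :=
  (h.slit_subset hu).trans h.subset_closedBall

/-! ### The maps `g_u` -/

/-- **The map `g_u : ℍ ∖ γ[0, u] → ℍ`** of the slit, hydrodynamically normalized
(`0 < u < 1`). [cite: Lawler2005, §4.1 (g_t = g_{γ(0,t]})] -/
def slitMap (h : SlitArcData A γ) {u : ℝ} (hu : u ∈ Ioo (0 : ℝ) 1) :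
    ConformalEquiv (upperHalfPlaneSet \ slit γ u) upperHalfPlaneSet :=
  (h.isPlusHull_slit hu).hydroMap (slit_nonempty γ hu.1.le)

/-- `g_u` is hydrodynamically normalized. [folklore] -/
theorem isHydrodynamicMap_slitMap (h : SlitArcData A γ) {u : ℝ} (hu : u ∈ Ioo (0 : ℝ) 1) :
    IsHydrodynamicMap (slit γ u) (h.slitMap hu) :=
  (h.isPlusHull_slit hu).isHydrodynamicMap_hydroMap _

/-- `γ[0, u] ∩ ℍ` is bounded. [folklore] -/
theorem isBounded_slit_inter (h : SlitArcData A γ) {u : ℝ} (hu : u < 1) :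
    IsBounded (slit γ u ∩ upperHalfPlaneSet) :=
  (h.isCompact.isBounded.subset (h.slit_subset hu)).subset inter_subset_left

/-- `γ[0, u] ∩ ℍ ⊆ B̄(re γ(0), R)`. [folklore] -/
theorem slit_inter_subset_closedBall (h : SlitArcData A γ) {u : ℝ} (hu : u < 1) :
    slit γ u ∩ upperHalfPlaneSet ⊆ closedBall (((γ 0).re : ℝ) : ℂ) (radius A γ) :=
  inter_subset_left.trans (h.slit_subset_closedBall hu)

/-- **`|g_u(z) - z| ≤ 580 R`** uniformly in `u` (Lawler (2005), (3.12)). [cite: Lawler2005, §3.4 (3.12)] -/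
theorem norm_slitMap_sub_self_le (h : SlitArcData A γ) {u : ℝ} (hu : u ∈ Ioo (0 : ℝ) 1) {z : ℂ}
    (hz : z ∈ upperHalfPlaneSet \ slit γ u) : ‖h.slitMap hu z - z‖ ≤ 580 * radius A γ :=
  (h.isHydrodynamicMap_slitMap hu).norm_sub_self_le (h.slit_inter_subset_closedBall hu.2) h.radius_pos hz

/-- The source `ℍ ∖ γ[0, u]` is open. [folklore] -/
theorem isOpen_diff_slit (h : SlitArcData A γ) {u : ℝ} (hu : u ∈ Ioo (0 : ℝ) 1) :
    IsOpen (upperHalfPlaneSet \ slit γ u) :=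
  IsHydrodynamicMap.isOpen_diff (h.slitMap hu)

/-! ### The length–area modulus -/

/-- The modulus `ω(d) = 8π (1 + 580 R)/√(log (1/d))`. [folklore] -/
def modulus (A : Set ℂ) (γ : ℝ → ℂ) (d : ℝ) : ℝ := 8 * π * (1 + 580 * radius A γ) / √(Real.log (1 / d))

/-- `ω(d) ≥ 0`. [folklore] -/
theorem modulus_nonneg (h : SlitArcData A γ) (d : ℝ) : 0 ≤ modulus A γ d := by
  unfold modulus
  have := h.radius_pos
  positivity

/-- **`ω(d)` is small for small `d`**: `ω(d) ≤ c` as soon as `d ≤ exp(-(8π(1 + 580R)/c)²)`. [folklore] -/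
theorem modulus_le (h : SlitArcData A γ) {c d : ℝ} (hc : 0 < c) (hd : 0 < d)
    (hdc : d ≤ Real.exp (-((8 * π * (1 + 580 * radius A γ) / c) ^ 2))) : modulus A γ d ≤ c := by
  have hR := h.radius_pos
  set M : ℝ := 8 * π * (1 + 580 * radius A γ) with hM
  have hM0 : 0 < M := by positivity
  have hlog : (M / c) ^ 2 ≤ Real.log (1 / d) := by
    rw [one_div, Real.log_inv, le_neg, ← Real.log_exp (-((M / c) ^ 2))]
    exact Real.log_le_log hd hdc
  have hsq : M / c ≤ √(Real.log (1 / d)) := by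
    rw [← Real.sqrt_sq (by positivity : 0 ≤ M / c)]
    exact Real.sqrt_le_sqrt hlog
  have hpos : 0 < √(Real.log (1 / d)) := lt_of_lt_of_le (by positivity) hsq
  rw [modulus, ← hM, div_le_iff₀ hpos]
  calc M = M / c * c := by field_simp
    _ ≤ √(Real.log (1 / d)) * c := by gcongr
    _ = c * √(Real.log (1 / d)) := mul_comm _ _

/-- A radius `d ∈ (0, 1/2]` with `ω(d) ≤ c`. [folklore] -/
theorem exists_modulus_le (h : SlitArcData A γ) {c : ℝ} (hc : 0 < c) :
    ∃ d : ℝ, 0 < d ∧ d ≤ 1 / 2 ∧ modulus A γ d ≤ c := by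
  refine ⟨min (1 / 2) (Real.exp (-((8 * π * (1 + 580 * radius A γ) / c) ^ 2))),
    lt_min (by norm_num) (Real.exp_pos _), min_le_left _ _, ?_⟩
  exact h.modulus_le hc (lt_min (by norm_num) (Real.exp_pos _)) (min_le_right _ _)

/-- **Length–area for the slit maps**: a preconnected `Q ⊆ H_u` inside a ball of radius `d < 1`
has `diam g_u(Q) ≤ ω(d)`. [cite: Lawler2005, §4.1 Lemma 4.1] -/
theorem norm_slitMap_sub_slitMap_le_modulus (h : SlitArcData A γ) {u : ℝ} (hu : u ∈ Ioo (0 : ℝ) 1)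
    {Q : Set ℂ} (hQ : IsPreconnected Q) (hQU : Q ⊆ upperHalfPlaneSet \ slit γ u) {p : ℂ} {d : ℝ}
    (hd : 0 < d) (hd1 : d < 1) (hQd : Q ⊆ ball p d) {z₁ z₂ : ℂ} (hz₁ : z₁ ∈ Q) (hz₂ : z₂ ∈ Q) :
    ‖h.slitMap hu z₁ - h.slitMap hu z₂‖ ≤ modulus A γ d :=
  LengthArea.norm_sub_le_of_isPreconnected (h.isOpen_diff_slit hu) (h.slitMap hu).differentiableOn
    (h.slitMap hu).mapsTo (h.slitMap hu).symm_mapsTo (h.slitMap hu).symm.continuousOn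
    (fun _ hw ↦ (h.slitMap hu).apply_symm_apply hw) (fun _ hz ↦ (h.slitMap hu).symm_apply_apply hz)
    (fun _ hz ↦ h.norm_slitMap_sub_self_le hu hz) hd hd1 hQ hQU hQd hz₁ hz₂

/-- The same for enclosed sets (`LengthAreaEnclosure`). [cite: Lawler2005, §4.1 Lemma 4.1] -/
theorem norm_slitMap_sub_slitMap_le_modulus_of_isEnclosedBy (h : SlitArcData A γ) {u : ℝ}
    (hu : u ∈ Ioo (0 : ℝ) 1) {Q : Set ℂ} (hQ : IsPreconnected Q) (hQU : Q ⊆ upperHalfPlaneSet \ slit γ u)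
    {p : ℂ} {d R₀ : ℝ} (hd : 0 < d) (hd1 : d < 1)
    (henc : LengthArea.IsEnclosedBy (upperHalfPlaneSet \ slit γ u) Q p d R₀) {z₁ z₂ : ℂ}
    (hz₁ : z₁ ∈ Q) (hz₂ : z₂ ∈ Q) : ‖h.slitMap hu z₁ - h.slitMap hu z₂‖ ≤ modulus A γ d :=
  LengthArea.norm_sub_le_of_isEnclosedBy (h.isOpen_diff_slit hu) (h.slitMap hu).differentiableOn
    (h.slitMap hu).mapsTo (h.slitMap hu).symm_mapsTo (h.slitMap hu).symm.continuousOn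
    (fun _ hw ↦ (h.slitMap hu).apply_symm_apply hw) (fun _ hz ↦ (h.slitMap hu).symm_apply_apply hz)
    (fun _ hz ↦ h.norm_slitMap_sub_self_le hu hz) hd hd1 hQ hQU henc hz₁ hz₂

/-! ### Uniform continuity of `γ` and of its inverse -/

/-- Uniform continuity of `γ` on `[0, 1]`. [folklore] -/
theorem exists_forall_norm_sub_lt (h : SlitArcData A γ) {ε : ℝ} (hε : 0 < ε) :
    ∃ δ > 0, ∀ s ∈ Icc (0 : ℝ) 1, ∀ t ∈ Icc (0 : ℝ) 1, |s - t| < δ → ‖γ s - γ t‖ < ε := by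
  have huc := isCompact_Icc.uniformContinuousOn_of_continuous h.continuousOn
  rw [Metric.uniformContinuousOn_iff] at huc
  obtain ⟨δ, hδ, hst⟩ := huc ε hε
  exact ⟨δ, hδ, fun s hs t ht hst' ↦ by
    have := hst s hs t ht (by rwa [Real.dist_eq])
    rwa [dist_eq_norm] at this⟩

/-- **Uniform continuity of the inverse parametrization**: points of the simple path which are
close in the plane are close in parameter. [folklore] -/
theorem exists_forall_abs_sub_lt (h : SlitArcData A γ) {η : ℝ} (hη : 0 < η) :
    ∃ ε > 0, ∀ s ∈ Icc (0 : ℝ) 1, ∀ t ∈ Icc (0 : ℝ) 1, ‖γ s - γ t‖ < ε → |s - t| < η := by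
  by_contra hcon
  push Not at hcon
  -- sequences `s n, t n` with `‖γ (s n) - γ (t n)‖ < 1/(n+1)` but `|s n - t n| ≥ η`
  have hseq : ∀ n : ℕ, ∃ p : ℝ × ℝ, p.1 ∈ Icc (0 : ℝ) 1 ∧ p.2 ∈ Icc (0 : ℝ) 1 ∧
      ‖γ p.1 - γ p.2‖ < 1 / (n + 1) ∧ η ≤ |p.1 - p.2| := fun n ↦ by
    obtain ⟨s, hs, t, ht, hst, hη'⟩ := hcon (1 / (n + 1)) (by positivity)
    exact ⟨(s, t), hs, ht, hst, hη'⟩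
  choose p hp using hseq
  have hK : IsCompact (Icc (0 : ℝ) 1 ×ˢ Icc (0 : ℝ) 1) := isCompact_Icc.prod isCompact_Icc
  obtain ⟨q, hq, φ, hφ, hlim⟩ := hK.tendsto_subseq fun n ↦ Set.mk_mem_prod (hp n).1 (hp n).2.1
  have hc1 : Tendsto (fun n ↦ γ (p (φ n)).1) atTop (𝓝 (γ q.1)) :=
    ((h.continuousOn q.1 hq.1).tendsto.comp
      (tendsto_nhdsWithin_iff.2 ⟨(continuous_fst.tendsto q).comp hlim,
        Eventually.of_forall fun n ↦ (hp (φ n)).1⟩))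
  have hc2 : Tendsto (fun n ↦ γ (p (φ n)).2) atTop (𝓝 (γ q.2)) :=
    ((h.continuousOn q.2 hq.2).tendsto.comp
      (tendsto_nhdsWithin_iff.2 ⟨(continuous_snd.tendsto q).comp hlim,
        Eventually.of_forall fun n ↦ (hp (φ n)).2.1⟩))
  have hdist : Tendsto (fun n ↦ ‖γ (p (φ n)).1 - γ (p (φ n)).2‖) atTop (𝓝 0) := by
    have h0 : Tendsto (fun n : ℕ ↦ (1 : ℝ) / ((φ n : ℝ) + 1)) atTop (𝓝 0) := by
      have h1 : Tendsto (fun n : ℕ ↦ (1 : ℝ) / ((n : ℝ) + 1)) atTop (𝓝 0) :=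
        tendsto_one_div_add_atTop_nhds_zero_nat
      exact h1.comp hφ.tendsto_atTop
    refine squeeze_zero (fun n ↦ norm_nonneg _) (fun n ↦ (hp (φ n)).2.2.1.le) h0
  have heq : γ q.1 = γ q.2 := by
    have := (hc1.sub hc2).norm
    have h0 := tendsto_nhds_unique this hdist
    exact sub_eq_zero.1 (norm_eq_zero.1 h0)
  have hq12 : q.1 = q.2 := h.injOn hq.1 hq.2 heq
  have habs : Tendsto (fun n ↦ |(p (φ n)).1 - (p (φ n)).2|) atTop (𝓝 |q.1 - q.2|) :=
    (((continuous_fst.tendsto q).comp hlim).sub ((continuous_snd.tendsto q).comp hlim)).abs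
  rw [hq12, sub_self, abs_zero] at habs
  have := ge_of_tendsto' habs fun n ↦ (hp (φ n)).2.2.2
  linarith

/-! ### The first hit of a segment with the slit -/

/-- The straight segment `c(λ) = z + λ (γ(u) - z)` from `z` to the tip `γ(u)`. [folklore] -/
def tipSegment (γ : ℝ → ℂ) (u : ℝ) (z : ℂ) (l : ℝ) : ℂ := z + l * (γ u - z)

/-- `c(0) = z`. [folklore] -/
@[simp] theorem tipSegment_zero (γ : ℝ → ℂ) (u : ℝ) (z : ℂ) : tipSegment γ u z 0 = z := by
  simp [tipSegment]

/-- `c(1) = γ(u)`. [folklore] -/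
@[simp] theorem tipSegment_one (γ : ℝ → ℂ) (u : ℝ) (z : ℂ) : tipSegment γ u z 1 = γ u := by
  simp [tipSegment]

/-- `c` is continuous. [folklore] -/
theorem continuous_tipSegment (γ : ℝ → ℂ) (u : ℝ) (z : ℂ) : Continuous (tipSegment γ u z) := by
  unfold tipSegment; fun_prop

/-- Points of the segment are within `‖z - γ(u)‖` of the tip. [folklore] -/
theorem norm_tipSegment_sub_le (γ : ℝ → ℂ) (u : ℝ) (z : ℂ) {l : ℝ} (hl : l ∈ Icc (0 : ℝ) 1) :
    ‖tipSegment γ u z l - γ u‖ ≤ ‖z - γ u‖ := by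
  have : tipSegment γ u z l - γ u = (1 - l) * (z - γ u) := by
    unfold tipSegment; ring
  rw [this, norm_mul, show ((1 : ℂ) - l) = ((1 - l : ℝ) : ℂ) by push_cast; ring, norm_real,
    Real.norm_of_nonneg (by linarith [hl.2])]
  exact mul_le_of_le_one_left (norm_nonneg _) (by linarith [hl.1])

/-- Points of the segment are in `ℍ` when `z` and `γ(u)` are. [folklore] -/
theorem tipSegment_im_pos (γ : ℝ → ℂ) (u : ℝ) {z : ℂ} (hz : 0 < z.im) (hu : 0 < (γ u).im) {l : ℝ}
    (hl : l ∈ Icc (0 : ℝ) 1) : 0 < (tipSegment γ u z l).im := by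
  have : (tipSegment γ u z l).im = (1 - l) * z.im + l * (γ u).im := by
    simp [tipSegment]; ring
  rw [this]
  rcases hl.1.lt_or_eq with h0 | h0
  · exact add_pos_of_nonneg_of_pos (mul_nonneg (by linarith [hl.2]) hz.le) (mul_pos h0 hu)
  · rw [← h0]; simpa using hz

/-- **First hit**: for `z ∈ H_u` the segment from `z` to `γ(u)` first meets `γ[0, u]` at a
parameter `λ* ∈ (0, 1]`, at a point `γ(u')`, `u' ∈ [0, u]`. [folklore] -/
theorem exists_first_hit (h : SlitArcData A γ) {u : ℝ} (hu : u ∈ Ioo (0 : ℝ) 1) {z : ℂ}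
    (hz : z ∈ upperHalfPlaneSet \ slit γ u) :
    ∃ l ∈ Ioc (0 : ℝ) 1, ∃ u' ∈ Icc (0 : ℝ) u, tipSegment γ u z l = γ u' ∧
      ∀ l' ∈ Ico (0 : ℝ) l, tipSegment γ u z l' ∉ slit γ u := by
  set S : Set ℝ := {l ∈ Icc (0 : ℝ) 1 | tipSegment γ u z l ∈ slit γ u} with hS
  have hSc : IsClosed S := by
    have hK : IsClosed (slit γ u) :=
      (isCompact_Icc.image_of_continuousOn (h.continuousOn.mono (Icc_subset_Icc_right hu.2.le))).isClosed
    exact isClosed_Icc.inter (hK.preimage (continuous_tipSegment γ u z))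
  have h1S : (1 : ℝ) ∈ S := ⟨⟨zero_le_one, le_rfl⟩, by
    rw [tipSegment_one]; exact ⟨u, ⟨hu.1.le, le_rfl⟩, rfl⟩⟩
  have hSne : S.Nonempty := ⟨1, h1S⟩
  have hSbdd : BddBelow S := ⟨0, fun l hl ↦ hl.1.1⟩
  set l : ℝ := sInf S with hl
  have hlS : l ∈ S := hSc.csInf_mem hSne hSbdd
  have hl1 : l ≤ 1 := csInf_le hSbdd h1S
  have hl0 : 0 < l := by
    rcases hlS.1.1.lt_or_eq with h0 | h0
    · exact h0
    · exfalso
      have := hlS.2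
      rw [← h0, tipSegment_zero] at this
      exact hz.2 this
  obtain ⟨u', hu', heq⟩ := hlS.2
  refine ⟨l, ⟨hl0, hl1⟩, u', hu', heq.symm, fun l' hl' hmem ↦ ?_⟩
  have : l ≤ l' := csInf_le hSbdd ⟨⟨hl'.1, hl'.2.le.trans hl1⟩, hmem⟩
  linarith [hl'.2]

/-! ### The modulus: positivity and monotonicity -/

/-- `‖a + b - c‖ ≤ ‖a‖ + ‖b‖ + ‖c‖`. [folklore] -/
theorem norm_add_sub_le_three (a b c : ℂ) : ‖a + b - c‖ ≤ ‖a‖ + ‖b‖ + ‖c‖ :=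
  (norm_sub_le (a + b) c).trans (by gcongr; exact norm_add_le a b)


/-- `ω(d) > 0` for `0 < d < 1`. [folklore] -/
theorem modulus_pos (h : SlitArcData A γ) {d : ℝ} (hd : 0 < d) (hd1 : d < 1) : 0 < modulus A γ d := by
  unfold modulus
  have := h.radius_pos
  have hlog : 0 < Real.log (1 / d) := Real.log_pos (by rw [lt_div_iff₀ hd]; linarith)
  positivity

/-- `ω` is monotone on `(0, 1)`. [folklore] -/
theorem modulus_mono (h : SlitArcData A γ) {d d' : ℝ} (hd' : 0 < d') (hdd' : d' ≤ d) (hd1 : d < 1) :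
    modulus A γ d' ≤ modulus A γ d := by
  unfold modulus
  have := h.radius_pos
  have hd : 0 < d := hd'.trans_le hdd'
  have hlog : 0 < Real.log (1 / d) := Real.log_pos (by rw [lt_div_iff₀ hd]; linarith)
  have hle : Real.log (1 / d) ≤ Real.log (1 / d') :=
    Real.log_le_log (by positivity) (one_div_le_one_div_of_le hd' hdd')
  gcongr

/-! ### Intermediate maps `g_{u'',u} = g_u ∘ g_{u''}⁻¹` -/

/-- `H_u ⊆ H_{u''}` for `u'' ≤ u`. [folklore] -/
theorem diff_slit_subset (γ : ℝ → ℂ) {u'' u : ℝ} (huu : u'' ≤ u) :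
    upperHalfPlaneSet \ slit γ u ⊆ upperHalfPlaneSet \ slit γ u'' :=
  fun _ hz ↦ ⟨hz.1, fun hzT ↦ hz.2 (slit_mono γ huu hzT)⟩

/-- The image hull of `γ[0, u]` under `g_{u''}` is `g_{u''}(γ(u'', u])`. [folklore] -/
theorem diffImage_slit_eq (h : SlitArcData A γ) {u'' u : ℝ} (hu'' : u'' ∈ Ioo (0 : ℝ) 1)
    (hu : u ∈ Ioo (0 : ℝ) 1) (huu : u'' ≤ u) :
    diffImage (h.slitMap hu'') (slit γ u) = h.slitMap hu'' '' (γ '' Ioc u'' u) := by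
  rw [diffImage, h.diff_inter_slit_eq hu''.1.le huu hu.2]

/-- **The image `g_{u''}(γ(u'', u])` is a small hull near the real axis** when `γ(u'', u]` is
within `d` of `γ(u)`: it lies in `B̄(x, 2ω(d))` for some real `x` (length–area for the
connected `γ(u'', u] ⊆ H_{u''}`, plus `Im g_{u''}(γ(t)) → 0` as `t ↓ u''`).
[cite: Lawler2005, §4.1 Lemma 4.1] -/
theorem exists_diffImage_subset_closedBall (h : SlitArcData A γ) {u'' u : ℝ} (hu'' : u'' ∈ Ioo (0 : ℝ) 1)
    (hu : u ∈ Ioo (0 : ℝ) 1) (huu : u'' < u) {d : ℝ} (hd : 0 < d) (hd1 : d < 1)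
    (hclose : ∀ t ∈ Ioc u'' u, ‖γ t - γ u‖ < d) :
    ∃ x : ℝ, diffImage (h.slitMap hu'') (slit γ u) ⊆ closedBall (x : ℂ) (2 * modulus A γ d) := by
  set g := h.slitMap hu'' with hg
  set Q : Set ℂ := γ '' Ioc u'' u with hQ
  have hQU : Q ⊆ upperHalfPlaneSet \ slit γ u'' := by
    rw [hQ, ← h.diff_inter_slit_eq hu''.1.le huu.le hu.2]; exact inter_subset_left
  have hQc : IsPreconnected Q :=
    isPreconnected_Ioc.image _ (h.continuousOn.mono fun t ht ↦ ⟨hu''.1.le.trans ht.1.le, ht.2.trans hu.2.le⟩)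
  have hQd : Q ⊆ ball (γ u) d := by
    rintro _ ⟨t, ht, rfl⟩
    rw [mem_ball, dist_eq_norm]; exact hclose t ht
  have hdiam : ∀ a ∈ Q, ∀ b ∈ Q, ‖g a - g b‖ ≤ modulus A γ d := fun a ha b hb ↦
    h.norm_slitMap_sub_slitMap_le_modulus hu'' hQc hQU hd hd1 hQd ha hb
  -- a point of `Q` whose image has small imaginary part
  have hω : 0 < modulus A γ d := h.modulus_pos hd hd1
  have hk : γ u'' ∉ upperHalfPlaneSet \ slit γ u'' := fun hk ↦ hk.2 ⟨u'', ⟨hu''.1.le, le_rfl⟩, rfl⟩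
  have him := (h.isHydrodynamicMap_slitMap hu'').tendsto_im_nhdsWithin (h.isBounded_slit_inter hu''.2) hk
  have hγt : Tendsto γ (𝓝[>] u'') (𝓝[upperHalfPlaneSet \ slit γ u''] (γ u'')) := by
    refine tendsto_nhdsWithin_iff.2 ⟨?_, ?_⟩
    · have hIcc : Ioi u'' ∩ Iio 1 ⊆ Icc (0 : ℝ) 1 := fun t ht ↦ ⟨hu''.1.le.trans (le_of_lt ht.1), le_of_lt ht.2⟩
      have h1 : Tendsto γ (𝓝[Icc 0 1] u'') (𝓝 (γ u'')) := (h.continuousOn u'' ⟨hu''.1.le, hu''.2.le⟩).tendsto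
      have h2 : 𝓝[>] u'' ≤ 𝓝[Icc 0 1] u'' := by
        rw [← nhdsWithin_inter_of_mem' (mem_nhdsWithin_of_mem_nhds (Iio_mem_nhds hu''.2))]
        exact nhdsWithin_mono _ hIcc
      exact h1.mono_left h2
    · filter_upwards [Ioo_mem_nhdsGT huu] with t ht
      exact hQU ⟨t, ⟨ht.1, ht.2.le⟩, rfl⟩
  have hev : ∀ᶠ t in 𝓝[>] u'', (g (γ t)).im < modulus A γ d ∧ t ∈ Ioo u'' u :=
    ((tendsto_order.1 (him.comp hγt)).2 _ hω).and (Ioo_mem_nhdsGT huu)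
  obtain ⟨t₀, ht₀im, ht₀⟩ := hev.exists
  set w₀ := g (γ t₀) with hw₀
  have hw₀Q : γ t₀ ∈ Q := ⟨t₀, ⟨ht₀.1, ht₀.2.le⟩, rfl⟩
  have hw₀im : 0 < w₀.im := IsHydrodynamicMap.im_pos (hQU hw₀Q)
  refine ⟨w₀.re, ?_⟩
  rw [h.diffImage_slit_eq hu'' hu huu.le]
  rintro _ ⟨q, hq, rfl⟩
  rw [mem_closedBall, dist_eq_norm]
  have h1 := hdiam q hq (γ t₀) hw₀Q
  have h2 : ‖w₀ - (w₀.re : ℂ)‖ = |w₀.im| := by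
    have : w₀ - (w₀.re : ℂ) = (w₀.im : ℂ) * I := by
      apply Complex.ext <;> simp
    rw [this, norm_mul, norm_real, norm_I, mul_one, Real.norm_eq_abs]
  rw [abs_of_pos hw₀im] at h2
  calc ‖g q - (w₀.re : ℂ)‖ = ‖(g q - w₀) + (w₀ - (w₀.re : ℂ))‖ := by ring_nf
    _ ≤ ‖g q - w₀‖ + ‖w₀ - (w₀.re : ℂ)‖ := norm_add_le _ _
    _ ≤ modulus A γ d + modulus A γ d := add_le_add h1 (by rw [h2]; exact ht₀im.le)
    _ = 2 * modulus A γ d := by ring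

/-- The slit `γ[0, u]` lies within `r` of `γ(0)` when all its points do. [folklore] -/
theorem slit_inter_subset_closedBall_of (γ : ℝ → ℂ) {u r : ℝ} (h0 : (γ 0).im = 0)
    (hr : ∀ t ∈ Icc (0 : ℝ) u, ‖γ t - γ 0‖ ≤ r) :
    slit γ u ∩ upperHalfPlaneSet ⊆ closedBall (((γ 0).re : ℝ) : ℂ) r := by
  rintro _ ⟨⟨t, ht, rfl⟩, -⟩
  have h0' : γ 0 = (((γ 0).re : ℝ) : ℂ) := Complex.ext (by simp) (by simp [h0])
  rw [mem_closedBall, dist_eq_norm, ← h0']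
  exact hr t ht

/-! ### The Cauchy estimate at the tip (Lawler (2005), Lemma 4.2) -/

/-- **Cauchy estimate at the tip, uniformly in `u`**: for every `ε₀ > 0` there is `ε > 0` such
that for all `0 < u < 1` and `z₁, z₂ ∈ H_u` within `ε` of `γ(u)`,
`‖g_u(z₁) - g_u(z₂)‖ ≤ ε₀`. (Lawler (2005), proof of Lemma 4.2: the segment from `z_i` to
`γ(u)` first meets `γ[0, u]` at `γ(u'_i)` with `u - u'_i` small; here the segment followed by
`γ[u'_i, u]` is a small connected subset of `H_{u''}`, `u'' = u - 2η < u'_i`, so the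
length–area modulus applies to `g_{u''}`, and `g_u = g_{u'',u} ∘ g_{u''}` with
`|g_{u'',u} - id| ≤ 580 rad g_{u''}(γ(u'', u])`.) [cite: Lawler2005, §4.1 Lemma 4.2] -/
theorem tip_cauchy (h : SlitArcData A γ) {ε₀ : ℝ} (hε₀ : 0 < ε₀) :
    ∃ ε > 0, ∀ ⦃u : ℝ⦄ (hu : u ∈ Ioo (0 : ℝ) 1) ⦃z₁ z₂ : ℂ⦄,
      z₁ ∈ upperHalfPlaneSet \ slit γ u → z₂ ∈ upperHalfPlaneSet \ slit γ u →
      ‖z₁ - γ u‖ < ε → ‖z₂ - γ u‖ < ε → ‖h.slitMap hu z₁ - h.slitMap hu z₂‖ ≤ ε₀ := by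
  -- the scale `d₁` with `ω(d₁) ≤ ε₀/2400` and `d₁ ≤ ε₀/1200`
  obtain ⟨d, hd, hd2, hdω⟩ := h.exists_modulus_le (by positivity : 0 < ε₀ / 2400)
  set d₁ : ℝ := min d (ε₀ / 1200) with hd₁
  have hd₁0 : 0 < d₁ := lt_min hd (by positivity)
  have hd₁1 : d₁ < 1 := (min_le_left _ _).trans_lt (by linarith)
  have hd₁ω : modulus A γ d₁ ≤ ε₀ / 2400 :=
    (h.modulus_mono hd₁0 (min_le_left _ _) (by linarith)).trans hdω
  have hd₁ε : d₁ ≤ ε₀ / 1200 := min_le_right _ _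
  -- uniform continuity of `γ` at scale `d₁/2`, and of its inverse at scale `η = δ/3`
  obtain ⟨δ, hδ, hγδ⟩ := h.exists_forall_norm_sub_lt (by positivity : 0 < d₁ / 2)
  set η : ℝ := δ / 3 with hη
  have hη0 : 0 < η := by positivity
  obtain ⟨ε₁, hε₁, hγη⟩ := h.exists_forall_abs_sub_lt hη0
  set ε : ℝ := min ε₁ (d₁ / 2) with hεdef
  have hε0 : 0 < ε := lt_min hε₁ (by positivity)
  have hεε₁ : ε ≤ ε₁ := min_le_left _ _
  have hεd : ε ≤ d₁ / 2 := min_le_right _ _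
  refine ⟨ε, hε0, fun u hu z₁ z₂ hz₁ hz₂ hz₁ε hz₂ε ↦ ?_⟩
  have hu1 : u ∈ Icc (0 : ℝ) 1 := ⟨hu.1.le, hu.2.le⟩
  rcases le_or_gt u (2 * η) with hcase | hcase
  · -- Case A: a short slit; `g_u` is close to the identity
    have hr : ∀ t ∈ Icc (0 : ℝ) u, ‖γ t - γ 0‖ ≤ d₁ / 2 := fun t ht ↦ by
      refine (hγδ t ⟨ht.1, ht.2.trans hu.2.le⟩ 0 ⟨le_rfl, zero_le_one⟩ ?_).le
      rw [sub_zero, abs_of_nonneg ht.1]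
      calc t ≤ u := ht.2
        _ ≤ 2 * η := hcase
        _ < δ := by rw [hη]; linarith
    have hK := slit_inter_subset_closedBall_of γ h.im_zero hr
    have h1 := (h.isHydrodynamicMap_slitMap hu).norm_sub_self_le hK (by positivity) hz₁
    have h2 := (h.isHydrodynamicMap_slitMap hu).norm_sub_self_le hK (by positivity) hz₂
    have h3 : ‖z₁ - z₂‖ < d₁ := by
      calc ‖z₁ - z₂‖ = ‖(z₁ - γ u) - (z₂ - γ u)‖ := by ring_nf
        _ ≤ ‖z₁ - γ u‖ + ‖z₂ - γ u‖ := norm_sub_le _ _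
        _ < ε + ε := add_lt_add hz₁ε hz₂ε
        _ ≤ d₁ := by linarith
    calc ‖h.slitMap hu z₁ - h.slitMap hu z₂‖
        = ‖(h.slitMap hu z₁ - z₁) + (z₁ - z₂) - (h.slitMap hu z₂ - z₂)‖ := by ring_nf
      _ ≤ ‖h.slitMap hu z₁ - z₁‖ + ‖z₁ - z₂‖ + ‖h.slitMap hu z₂ - z₂‖ := norm_add_sub_le_three _ _ _
      _ ≤ 580 * (d₁ / 2) + d₁ + 580 * (d₁ / 2) := by linarith
      _ ≤ ε₀ := by linarith
  · -- Case B: `u'' = u - 2η`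
    set u'' : ℝ := u - 2 * η with hu''def
    have hu'' : u'' ∈ Ioo (0 : ℝ) 1 := ⟨by rw [hu''def]; linarith, by rw [hu''def]; linarith [hu.2]⟩
    have hu''u : u'' < u := by rw [hu''def]; linarith
    set g'' := h.slitMap hu'' with hg''
    set g := h.slitMap hu with hgdef
    -- the intermediate map and its hull
    have h12 : upperHalfPlaneSet \ slit γ u ⊆ upperHalfPlaneSet \ slit γ u'' := diff_slit_subset γ hu''u.le
    set ψ := diffQuotient g'' g h12 with hψ
    have hψH : IsHydrodynamicMap (diffImage g'' (slit γ u)) ψ :=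
      (h.isHydrodynamicMap_slitMap hu'').diffQuotient (h.isHydrodynamicMap_slitMap hu)
        (h.isBounded_slit_inter hu''.2) h12
    have hclose : ∀ t ∈ Ioc u'' u, ‖γ t - γ u‖ < d₁ := fun t ht ↦ by
      have := hγδ t ⟨hu''.1.le.trans ht.1.le, ht.2.trans hu.2.le⟩ u hu1 (by
        rw [abs_of_nonpos (by linarith [ht.2]), neg_sub]
        calc u - t < u - u'' := by linarith [ht.1]
          _ = 2 * η := by rw [hu''def]; ring
          _ < δ := by rw [hη]; linarith)
      linarith
    obtain ⟨x, hKx⟩ := h.exists_diffImage_subset_closedBall hu'' hu hu''u hd₁0 hd₁1 hclose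
    have hω0 : 0 < modulus A γ d₁ := h.modulus_pos hd₁0 hd₁1
    have hKx' : diffImage g'' (slit γ u) ∩ upperHalfPlaneSet ⊆ closedBall (x : ℂ) (2 * modulus A γ d₁) :=
      inter_subset_left.trans hKx
    have hψid : ∀ w ∈ upperHalfPlaneSet \ diffImage g'' (slit γ u), ‖ψ w - w‖ ≤ 580 * (2 * modulus A γ d₁) :=
      fun w hw ↦ hψH.norm_sub_self_le hKx' (by positivity) hw
    -- the estimate `‖g'' zᵢ - g'' (γ u)‖ ≤ ω(d₁)` for each `i`
    have key : ∀ z : ℂ, z ∈ upperHalfPlaneSet \ slit γ u → ‖z - γ u‖ < ε →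
        ‖g'' z - g'' (γ u)‖ ≤ modulus A γ d₁ := by
      intro z hz hzε
      obtain ⟨l, hl, u', hu', hlu', hfirst⟩ := h.exists_first_hit hu hz
      -- `u - u' < η`
      have hu'1 : u' ∈ Icc (0 : ℝ) 1 := ⟨hu'.1, hu'.2.trans hu.2.le⟩
      have hnear : |u' - u| < η := by
        refine hγη u' hu'1 u hu1 ?_
        rw [← hlu']
        exact (norm_tipSegment_sub_le γ u z ⟨hl.1.le, hl.2⟩).trans_lt (hzε.trans_le hεε₁)
      have hu''u' : u'' < u' := by
        have := neg_abs_le (u' - u)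
        rw [hu''def]; linarith
      -- the connected set `Q = c[0, l] ∪ γ[u', u]`
      set Q : Set ℂ := tipSegment γ u z '' Icc 0 l ∪ γ '' Icc u' u with hQ
      have hγuH : 0 < (γ u).im := h.im_pos u hu
      have hQU : Q ⊆ upperHalfPlaneSet \ slit γ u'' := by
        rintro q (⟨l', hl', rfl⟩ | ⟨t, ht, rfl⟩)
        · rcases hl'.2.lt_or_eq with hlt | heq
          · refine ⟨tipSegment_im_pos γ u hz.1 hγuH ⟨hl'.1, hlt.le.trans hl.2⟩, fun hmem ↦ ?_⟩
            exact hfirst l' ⟨hl'.1, hlt⟩ (slit_mono γ hu''u.le hmem)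
          · rw [heq, hlu']
            exact h.apply_mem_diff_slit hu''.1.le hu''u' (hu'.2.trans_lt hu.2)
        · exact h.apply_mem_diff_slit hu''.1.le (hu''u'.trans_le ht.1) (ht.2.trans_lt hu.2)
      have hQc : IsPreconnected Q := by
        refine IsPreconnected.union' ⟨γ u', ⟨l, ⟨hl.1.le, le_rfl⟩, hlu'⟩, ⟨u', ⟨le_rfl, hu'.2⟩, rfl⟩⟩ ?_ ?_
        · exact isPreconnected_Icc.image _ (continuous_tipSegment γ u z).continuousOn
        · exact isPreconnected_Icc.image _ (h.continuousOn.mono (Icc_subset_Icc hu'.1 hu.2.le))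
      have hQd : Q ⊆ ball (γ u) d₁ := by
        rintro q (⟨l', hl', rfl⟩ | ⟨t, ht, rfl⟩)
        · rw [mem_ball, dist_eq_norm]
          calc ‖tipSegment γ u z l' - γ u‖ ≤ ‖z - γ u‖ := norm_tipSegment_sub_le γ u z ⟨hl'.1, hl'.2.trans hl.2⟩
            _ < ε := hzε
            _ < d₁ := by linarith
        · rw [mem_ball, dist_eq_norm]
          have := hγδ t ⟨hu'.1.trans ht.1, ht.2.trans hu.2.le⟩ u hu1 (by
            rw [abs_of_nonpos (by linarith [ht.2]), neg_sub]
            have := le_abs_self (u' - u)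
            have h' := neg_abs_le (u' - u)
            calc u - t ≤ u - u' := by linarith [ht.1]
              _ < η := by linarith
              _ < δ := by rw [hη]; linarith)
          linarith
      have hzQ : z ∈ Q := Or.inl ⟨0, ⟨le_rfl, hl.1.le⟩, tipSegment_zero γ u z⟩
      have huQ : γ u ∈ Q := Or.inr ⟨u, ⟨hu'.2, le_rfl⟩, rfl⟩
      exact h.norm_slitMap_sub_slitMap_le_modulus hu'' hQc hQU hd₁0 hd₁1 hQd hzQ huQ
    -- assemble: `g zᵢ = ψ (g'' zᵢ)`
    have hrepr : ∀ z : ℂ, z ∈ upperHalfPlaneSet \ slit γ u → g z = ψ (g'' z) := fun z hz ↦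
      (diffQuotient_apply_apply h12 hz).symm
    have hmem : ∀ z : ℂ, z ∈ upperHalfPlaneSet \ slit γ u →
        g'' z ∈ upperHalfPlaneSet \ diffImage g'' (slit γ u) := fun z hz ↦ mapsTo_diff_diffImage h12 hz
    have e1 := hψid _ (hmem z₁ hz₁)
    have e2 := hψid _ (hmem z₂ hz₂)
    have k1 := key z₁ hz₁ hz₁ε
    have k2 := key z₂ hz₂ hz₂ε
    rw [hrepr z₁ hz₁, hrepr z₂ hz₂]
    calc ‖ψ (g'' z₁) - ψ (g'' z₂)‖
        = ‖(ψ (g'' z₁) - g'' z₁) + ((g'' z₁ - g'' (γ u)) - (g'' z₂ - g'' (γ u))) - (ψ (g'' z₂) - g'' z₂)‖ := by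
          ring_nf
      _ ≤ ‖ψ (g'' z₁) - g'' z₁‖ + ‖(g'' z₁ - g'' (γ u)) - (g'' z₂ - g'' (γ u))‖ + ‖ψ (g'' z₂) - g'' z₂‖ :=
          norm_add_sub_le_three _ _ _
      _ ≤ ‖ψ (g'' z₁) - g'' z₁‖ + (‖g'' z₁ - g'' (γ u)‖ + ‖g'' z₂ - g'' (γ u)‖) + ‖ψ (g'' z₂) - g'' z₂‖ := by
          gcongr; exact norm_sub_le _ _
      _ ≤ 580 * (2 * modulus A γ d₁) + (modulus A γ d₁ + modulus A γ d₁) + 580 * (2 * modulus A γ d₁) := by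
          gcongr
      _ = 2322 * modulus A γ d₁ := by ring
      _ ≤ ε₀ := by linarith

/-! ### The tip value `U_u` (Lawler (2005), Lemma 4.2) -/

/-- `γ(t) → γ(u)` as `t ↓ u` (`0 ≤ u < 1`). [folklore] -/
theorem tendsto_nhdsGT (h : SlitArcData A γ) {u : ℝ} (hu : u ∈ Ico (0 : ℝ) 1) :
    Tendsto γ (𝓝[>] u) (𝓝 (γ u)) := by
  have hIcc : Ioi u ∩ Iio 1 ⊆ Icc (0 : ℝ) 1 := fun t ht ↦ ⟨hu.1.trans (le_of_lt ht.1), le_of_lt ht.2⟩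
  have h1 : Tendsto γ (𝓝[Icc 0 1] u) (𝓝 (γ u)) := (h.continuousOn u ⟨hu.1, hu.2.le⟩).tendsto
  have h2 : 𝓝[>] u ≤ 𝓝[Icc 0 1] u := by
    rw [← nhdsWithin_inter_of_mem' (mem_nhdsWithin_of_mem_nhds (Iio_mem_nhds hu.2))]
    exact nhdsWithin_mono _ hIcc
  exact h1.mono_left h2

/-- The tip `γ(u)` is in the closure of `H_u`: the filter `𝓝[H_u] γ(u)` is nontrivial. [folklore] -/
theorem nhdsWithin_tip_neBot (h : SlitArcData A γ) {u : ℝ} (hu : u ∈ Ioo (0 : ℝ) 1) :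
    (𝓝[upperHalfPlaneSet \ slit γ u] (γ u)).NeBot := by
  refine mem_closure_iff_nhdsWithin_neBot.1 (mem_closure_of_tendsto (h.tendsto_nhdsGT ⟨hu.1.le, hu.2⟩) ?_)
  filter_upwards [Ioo_mem_nhdsGT hu.2] with t ht
  exact h.apply_mem_diff_slit hu.1.le ht.1 ht.2

/-- **The tip value `U_u = lim_{z → γ(u), z ∈ H_u} g_u(z)`** (Lawler (2005), Lemma 4.2; real, see
`tendsto_slitMap_tip`). [cite: Lawler2005, §4.1 Lemma 4.2] -/
def tipVal (h : SlitArcData A γ) {u : ℝ} (hu : u ∈ Ioo (0 : ℝ) 1) : ℝ :=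
  (limUnder (𝓝[upperHalfPlaneSet \ slit γ u] (γ u)) (h.slitMap hu)).re

/-- **Existence of the tip value** (Lawler (2005), Lemma 4.2: "there is a unique `U_t ∈ ℝ` with
`lim_{z → γ(t)} g_t(z) = U_t`"): `g_u(z) → U_u` as `z → γ(u)` in `H_u`. (Cauchy criterion from
`tip_cauchy`; the limit is real since `Im g_u → 0` at the slit.) [cite: Lawler2005, §4.1 Lemma 4.2] -/
theorem tendsto_slitMap_tip (h : SlitArcData A γ) {u : ℝ} (hu : u ∈ Ioo (0 : ℝ) 1) :
    Tendsto (h.slitMap hu) (𝓝[upperHalfPlaneSet \ slit γ u] (γ u)) (𝓝 (h.tipVal hu : ℂ)) := by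
  set F := 𝓝[upperHalfPlaneSet \ slit γ u] (γ u) with hF
  haveI := h.nhdsWithin_tip_neBot hu
  have hC : Cauchy (map (h.slitMap hu) F) := by
    rw [Metric.cauchy_iff]
    refine ⟨inferInstance, fun ε hε ↦ ?_⟩
    obtain ⟨ε', hε', hC⟩ := h.tip_cauchy (half_pos hε)
    refine ⟨h.slitMap hu '' ((upperHalfPlaneSet \ slit γ u) ∩ ball (γ u) ε'),
      image_mem_map (inter_mem_nhdsWithin _ (ball_mem_nhds _ hε')), ?_⟩
    rintro _ ⟨z₁, ⟨hz₁, hz₁b⟩, rfl⟩ _ ⟨z₂, ⟨hz₂, hz₂b⟩, rfl⟩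
    rw [dist_eq_norm]
    rw [mem_ball, dist_eq_norm] at hz₁b hz₂b
    exact (hC hu hz₁ hz₂ hz₁b hz₂b).trans_lt (half_lt_self hε)
  obtain ⟨L, hL⟩ := CompleteSpace.complete hC
  have hL' : Tendsto (h.slitMap hu) F (𝓝 L) := hL
  have hk : γ u ∉ upperHalfPlaneSet \ slit γ u := fun hk ↦ hk.2 ⟨u, ⟨hu.1.le, le_rfl⟩, rfl⟩
  have him : Tendsto (fun z ↦ (h.slitMap hu z).im) F (𝓝 0) :=
    (h.isHydrodynamicMap_slitMap hu).tendsto_im_nhdsWithin (h.isBounded_slit_inter hu.2) hk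
  have hLim : L.im = 0 := tendsto_nhds_unique ((continuous_im.tendsto L).comp hL') him
  have hLeq : ((L.re : ℝ) : ℂ) = L := Complex.ext (by simp) (by simp [hLim])
  have : h.tipVal hu = L.re := by rw [tipVal, hL'.limUnder_eq]
  rw [this, hLeq]
  exact hL'

/-- **Uniform bound at the tip**: `‖g_u(z) - U_u‖ ≤ ε₀` for `z ∈ H_u` within `ε` of `γ(u)`,
uniformly in `u`. [cite: Lawler2005, §4.1 Lemma 4.2] -/
theorem norm_slitMap_sub_tipVal_le (h : SlitArcData A γ) {ε₀ : ℝ} (hε₀ : 0 < ε₀) :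
    ∃ ε > 0, ∀ ⦃u : ℝ⦄ (hu : u ∈ Ioo (0 : ℝ) 1) ⦃z : ℂ⦄, z ∈ upperHalfPlaneSet \ slit γ u →
      ‖z - γ u‖ < ε → ‖h.slitMap hu z - h.tipVal hu‖ ≤ ε₀ := by
  obtain ⟨ε, hε, hC⟩ := h.tip_cauchy hε₀
  refine ⟨ε, hε, fun u hu z hz hzε ↦ ?_⟩
  haveI := h.nhdsWithin_tip_neBot hu
  have hlim : Tendsto (fun z₂ ↦ ‖h.slitMap hu z - h.slitMap hu z₂‖)
      (𝓝[upperHalfPlaneSet \ slit γ u] (γ u)) (𝓝 ‖h.slitMap hu z - h.tipVal hu‖) :=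
    (tendsto_const_nhds.sub (h.tendsto_slitMap_tip hu)).norm
  refine le_of_tendsto hlim ?_
  filter_upwards [inter_mem_nhdsWithin _ (ball_mem_nhds (γ u) hε)] with z₂ hz₂
  rw [mem_inter_iff, mem_ball, dist_eq_norm] at hz₂
  exact hC hu hz hz₂.1 hzε hz₂.2

/-! ### Local growth and uniform continuity in `u` (Lawler (2005), Lemma 4.1, Remark 4.5) -/

/-- **Local growth**: `g_u(γ(u, u'])` lies in `B̄(U_u, ε₀)` when `u' - u` is small, uniformly
(Lawler (2005), Lemma 4.1, first assertion). [cite: Lawler2005, §4.1 Lemma 4.1] -/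
theorem exists_diffImage_subset_closedBall_tipVal (h : SlitArcData A γ) {ε₀ : ℝ} (hε₀ : 0 < ε₀) :
    ∃ θ > 0, ∀ ⦃u u' : ℝ⦄ (hu : u ∈ Ioo (0 : ℝ) 1) (hu' : u' ∈ Ioo (0 : ℝ) 1), u ≤ u' → u' - u < θ →
      diffImage (h.slitMap hu) (slit γ u') ⊆ closedBall ((h.tipVal hu : ℝ) : ℂ) ε₀ := by
  obtain ⟨ε, hε, hB⟩ := h.norm_slitMap_sub_tipVal_le hε₀
  obtain ⟨θ, hθ, hγθ⟩ := h.exists_forall_norm_sub_lt hε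
  refine ⟨θ, hθ, fun u u' hu hu' huu' hlt ↦ ?_⟩
  rw [h.diffImage_slit_eq hu hu' huu']
  rintro _ ⟨_, ⟨t, ht, rfl⟩, rfl⟩
  rw [mem_closedBall, dist_eq_norm]
  refine hB hu (h.apply_mem_diff_slit hu.1.le ht.1 (ht.2.trans_lt hu'.2)) ?_
  refine hγθ t ⟨hu.1.le.trans ht.1.le, ht.2.trans hu'.2.le⟩ u ⟨hu.1.le, hu.2.le⟩ ?_
  rw [abs_of_nonneg (by linarith [ht.1])]
  linarith [ht.2]

/-- **`‖g_{u'} - g_u‖_∞ ≤ ε₀` on `H_{u'}`** for `u ≤ u'` close, uniformly (Lawler (2005), Lemma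
4.1, second assertion: `g_{u'} = g_{u,u'} ∘ g_u` with `|g_{u,u'} - id| ≤ 580 rad`).
[cite: Lawler2005, §4.1 Lemma 4.1] -/
theorem norm_slitMap_sub_slitMap_le (h : SlitArcData A γ) {ε₀ : ℝ} (hε₀ : 0 < ε₀) :
    ∃ θ > 0, ∀ ⦃u u' : ℝ⦄ (hu : u ∈ Ioo (0 : ℝ) 1) (hu' : u' ∈ Ioo (0 : ℝ) 1), u ≤ u' → u' - u < θ →
      ∀ z ∈ upperHalfPlaneSet \ slit γ u', ‖h.slitMap hu' z - h.slitMap hu z‖ ≤ ε₀ := by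
  obtain ⟨θ, hθ, hK⟩ := h.exists_diffImage_subset_closedBall_tipVal (by positivity : 0 < ε₀ / 580)
  refine ⟨θ, hθ, fun u u' hu hu' huu' hlt z hz ↦ ?_⟩
  have h12 := diff_slit_subset γ huu'
  have hψ := (h.isHydrodynamicMap_slitMap hu).diffQuotient (h.isHydrodynamicMap_slitMap hu')
    (h.isBounded_slit_inter hu.2) h12
  have hKx : diffImage (h.slitMap hu) (slit γ u') ∩ upperHalfPlaneSet ⊆
      closedBall ((h.tipVal hu : ℝ) : ℂ) (ε₀ / 580) := inter_subset_left.trans (hK hu hu' huu' hlt)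
  have := hψ.norm_sub_self_le hKx (by positivity) (mapsTo_diff_diffImage h12 hz)
  rw [diffQuotient_apply_apply h12 hz] at this
  linarith

/-- **`u ↦ U_u` is uniformly continuous on `(0, 1)`** (Lawler (2005), Lemma 4.2: "`t ↦ U_t` is
continuous", via (4.2) `U_t = lim_{s ↑ t} g_s(γ(t))`). [cite: Lawler2005, §4.1 Lemma 4.2] -/
theorem abs_tipVal_sub_tipVal_le (h : SlitArcData A γ) {ε₀ : ℝ} (hε₀ : 0 < ε₀) :
    ∃ θ > 0, ∀ ⦃u u' : ℝ⦄ (hu : u ∈ Ioo (0 : ℝ) 1) (hu' : u' ∈ Ioo (0 : ℝ) 1), u ≤ u' → u' - u < θ →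
      |h.tipVal hu' - h.tipVal hu| ≤ ε₀ := by
  have hε3 : 0 < ε₀ / 3 := by positivity
  obtain ⟨θ₁, hθ₁, hmaps⟩ := h.norm_slitMap_sub_slitMap_le hε3
  obtain ⟨ε, hε, hB⟩ := h.norm_slitMap_sub_tipVal_le hε3
  obtain ⟨θ₂, hθ₂, hγθ⟩ := h.exists_forall_norm_sub_lt hε
  refine ⟨min θ₁ θ₂, lt_min hθ₁ hθ₂, fun u u' hu hu' huu' hlt ↦ ?_⟩
  rcases huu'.eq_or_lt with heq | hlt'
  · subst heq; simp [hε₀.le]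
  set F := 𝓝[upperHalfPlaneSet \ slit γ u'] (γ u') with hF
  haveI := h.nhdsWithin_tip_neBot hu'
  have hmemu : γ u' ∈ upperHalfPlaneSet \ slit γ u := h.apply_mem_diff_slit hu.1.le hlt' hu'.2
  -- eventually along `F`: `‖g_{u'} z - U_u‖ ≤ ε₀`
  have hev : ∀ᶠ z in F, ‖h.slitMap hu' z - h.tipVal hu‖ ≤ ε₀ := by
    have hcont : Tendsto (h.slitMap hu) (𝓝 (γ u')) (𝓝 (h.slitMap hu (γ u'))) :=
      ((h.slitMap hu).continuousOn.continuousAt ((h.isOpen_diff_slit hu).mem_nhds hmemu)).tendsto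
    have h1 : ∀ᶠ z in F, ‖h.slitMap hu z - h.slitMap hu (γ u')‖ < ε₀ / 3 := by
      have := (hcont.mono_left (nhdsWithin_le_nhds (s := upperHalfPlaneSet \ slit γ u'))) (ball_mem_nhds _ hε3)
      filter_upwards [this] with z hz
      rwa [mem_preimage, mem_ball, dist_eq_norm] at hz
    have h2 : ‖h.slitMap hu (γ u') - h.tipVal hu‖ ≤ ε₀ / 3 :=
      hB hu hmemu (hγθ u' ⟨hu'.1.le, hu'.2.le⟩ u ⟨hu.1.le, hu.2.le⟩ (by
        rw [abs_of_nonneg (by linarith)]; exact hlt.trans_le (min_le_right _ _)))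
    filter_upwards [h1, self_mem_nhdsWithin] with z hz hzU
    have h3 := hmaps hu hu' huu' (hlt.trans_le (min_le_left _ _)) z hzU
    calc ‖h.slitMap hu' z - h.tipVal hu‖
        = ‖(h.slitMap hu' z - h.slitMap hu z) + (h.slitMap hu z - h.slitMap hu (γ u'))
            + (h.slitMap hu (γ u') - h.tipVal hu)‖ := by ring_nf
      _ ≤ ‖h.slitMap hu' z - h.slitMap hu z‖ + ‖h.slitMap hu z - h.slitMap hu (γ u')‖
            + ‖h.slitMap hu (γ u') - h.tipVal hu‖ := norm_add₃_le
      _ ≤ ε₀ / 3 + ε₀ / 3 + ε₀ / 3 := by gcongr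
      _ = ε₀ := by ring
  have hlim : Tendsto (fun z ↦ ‖h.slitMap hu' z - h.tipVal hu‖) F
      (𝓝 ‖((h.tipVal hu' : ℝ) : ℂ) - h.tipVal hu‖) := ((h.tendsto_slitMap_tip hu').sub_const _).norm
  have := le_of_tendsto hlim hev
  rwa [← ofReal_sub, norm_real, Real.norm_eq_abs] at this

/-- **Continuity of `b(u) = hcap γ[0, u]`** (Lawler (2005), Remark 4.5): for `u ≤ u'` close,
`0 ≤ b(u') - b(u) ≤ ε₀`, uniformly (`b(u') - b(u) = hcap g_u(γ(u, u']) ≤ 288 rad²`).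
[cite: Lawler2005, §4.1 Remark 4.5] -/
theorem hcap_slit_sub_mem_Icc (h : SlitArcData A γ) {ε₀ : ℝ} (hε₀ : 0 < ε₀) :
    ∃ θ > 0, ∀ ⦃u u' : ℝ⦄ (hu : u ∈ Ioo (0 : ℝ) 1) (hu' : u' ∈ Ioo (0 : ℝ) 1), u ≤ u' → u' - u < θ →
      hcap (slit γ u') (h.slitMap hu') - hcap (slit γ u) (h.slitMap hu) ∈ Icc 0 ε₀ := by
  set r : ℝ := min 1 (ε₀ / 288) with hr
  have hr0 : 0 < r := lt_min one_pos (by positivity)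
  obtain ⟨θ, hθ, hK⟩ := h.exists_diffImage_subset_closedBall_tipVal hr0
  refine ⟨θ, hθ, fun u u' hu hu' huu' hlt ↦ ?_⟩
  have h12 := diff_slit_subset γ huu'
  have h₁ := h.isHydrodynamicMap_slitMap hu
  have h₂ := h.isHydrodynamicMap_slitMap hu'
  have hb₁ := h.isBounded_slit_inter hu.2
  have hb₂ := h.isBounded_slit_inter hu'.2
  have hψ := h₁.diffQuotient h₂ hb₁ h12
  have hadd := h₁.hcap_diffQuotient h₂ hb₁ hb₂ h12
  have hKx : diffImage (h.slitMap hu) (slit γ u') ∩ upperHalfPlaneSet ⊆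
      closedBall ((h.tipVal hu : ℝ) : ℂ) r := inter_subset_left.trans (hK hu hu' huu' hlt)
  have hle := hψ.hcap_le hKx hr0
  have hnn := hψ.hcap_nonneg (h₁.isBounded_diffImage hb₁ hb₂)
  rw [hadd] at hle hnn
  refine ⟨hnn, hle.trans ?_⟩
  have hr1 : r ≤ 1 := min_le_left _ _
  have hrε : r ≤ ε₀ / 288 := min_le_right _ _
  nlinarith

/-- **`b` is strictly increasing** (Lawler (2005), Remark 4.5; (3.8): the image hull
`g_u(γ(u, u'])` is nonempty). [cite: Lawler2005, §4.1 Remark 4.5] -/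
theorem hcap_slit_lt_hcap_slit (h : SlitArcData A γ) {u u' : ℝ} (hu : u ∈ Ioo (0 : ℝ) 1)
    (hu' : u' ∈ Ioo (0 : ℝ) 1) (huu' : u < u') :
    hcap (slit γ u) (h.slitMap hu) < hcap (slit γ u') (h.slitMap hu') := by
  have h12 := diff_slit_subset γ huu'.le
  have h₁ := h.isHydrodynamicMap_slitMap hu
  have h₂ := h.isHydrodynamicMap_slitMap hu'
  have hb₁ := h.isBounded_slit_inter hu.2
  have hb₂ := h.isBounded_slit_inter hu'.2
  have hψ := h₁.diffQuotient h₂ hb₁ h12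
  have hadd := h₁.hcap_diffQuotient h₂ hb₁ hb₂ h12
  have hne : (diffImage (h.slitMap hu) (slit γ u') ∩ upperHalfPlaneSet).Nonempty := by
    refine ⟨h.slitMap hu (γ u'), ?_, ?_⟩
    · rw [h.diffImage_slit_eq hu hu' huu'.le]
      exact ⟨γ u', ⟨u', ⟨huu', le_rfl⟩, rfl⟩, rfl⟩
    · exact (h.slitMap hu).mapsTo (h.apply_mem_diff_slit hu.1.le huu' hu'.2)
  have hpos := hψ.hcap_pos (h₁.isBounded_diffImage hb₁ hb₂) hne
  rw [hadd] at hpos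
  linarith

/-! ### Behaviour as `u → 0` -/

/-- For small `u` the slit lies in a small disc about `γ(0)`. [folklore] -/
theorem exists_slit_inter_subset_closedBall (h : SlitArcData A γ) {r : ℝ} (hr : 0 < r) :
    ∃ θ > 0, ∀ ⦃u : ℝ⦄, u ∈ Ioo (0 : ℝ) 1 → u < θ →
      slit γ u ∩ upperHalfPlaneSet ⊆ closedBall (((γ 0).re : ℝ) : ℂ) r ∧ ‖γ u - γ 0‖ < r := by
  obtain ⟨θ, hθ, hγθ⟩ := h.exists_forall_norm_sub_lt hr
  refine ⟨θ, hθ, fun u hu huθ ↦ ⟨slit_inter_subset_closedBall_of γ h.im_zero fun t ht ↦ ?_, ?_⟩⟩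
  · refine (hγθ t ⟨ht.1, ht.2.trans hu.2.le⟩ 0 ⟨le_rfl, zero_le_one⟩ ?_).le
    rw [sub_zero, abs_of_nonneg ht.1]; exact ht.2.trans_lt huθ
  · exact hγθ u ⟨hu.1.le, hu.2.le⟩ 0 ⟨le_rfl, zero_le_one⟩ (by rw [sub_zero, abs_of_pos hu.1]; exact huθ)

/-- **`U_u → γ(0)` as `u → 0`.** [cite: Lawler2005, §4.1 Lemma 4.2] -/
theorem norm_tipVal_sub_apply_zero_le (h : SlitArcData A γ) {ε₀ : ℝ} (hε₀ : 0 < ε₀) :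
    ∃ θ > 0, ∀ ⦃u : ℝ⦄ (hu : u ∈ Ioo (0 : ℝ) 1), u < θ → ‖((h.tipVal hu : ℝ) : ℂ) - γ 0‖ ≤ ε₀ := by
  obtain ⟨θ, hθ, hsmall⟩ := h.exists_slit_inter_subset_closedBall (by positivity : 0 < ε₀ / 581)
  refine ⟨θ, hθ, fun u hu huθ ↦ ?_⟩
  obtain ⟨hK, hγu⟩ := hsmall hu huθ
  haveI := h.nhdsWithin_tip_neBot hu
  have hev : ∀ᶠ z in 𝓝[upperHalfPlaneSet \ slit γ u] (γ u), ‖h.slitMap hu z - z‖ ≤ 580 * (ε₀ / 581) := by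
    filter_upwards [self_mem_nhdsWithin] with z hz
    exact (h.isHydrodynamicMap_slitMap hu).norm_sub_self_le hK (by positivity) hz
  have hlim : Tendsto (fun z ↦ ‖h.slitMap hu z - z‖) (𝓝[upperHalfPlaneSet \ slit γ u] (γ u))
      (𝓝 ‖((h.tipVal hu : ℝ) : ℂ) - γ u‖) :=
    ((h.tendsto_slitMap_tip hu).sub (tendsto_id.mono_left nhdsWithin_le_nhds)).norm
  have h1 := le_of_tendsto hlim hev
  calc ‖((h.tipVal hu : ℝ) : ℂ) - γ 0‖ = ‖(((h.tipVal hu : ℝ) : ℂ) - γ u) + (γ u - γ 0)‖ := by ring_nf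
    _ ≤ ‖((h.tipVal hu : ℝ) : ℂ) - γ u‖ + ‖γ u - γ 0‖ := norm_add_le _ _
    _ ≤ 580 * (ε₀ / 581) + ε₀ / 581 := add_le_add h1 hγu.le
    _ = ε₀ := by ring

/-- **`b(u) → 0` as `u → 0`** (`b(u) ≤ 288 rad(γ[0,u])²`). [cite: Lawler2005, §4.1 Remark 4.5] -/
theorem hcap_slit_le_of_lt (h : SlitArcData A γ) {ε₀ : ℝ} (hε₀ : 0 < ε₀) :
    ∃ θ > 0, ∀ ⦃u : ℝ⦄ (hu : u ∈ Ioo (0 : ℝ) 1), u < θ → hcap (slit γ u) (h.slitMap hu) ≤ ε₀ := by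
  set r : ℝ := min 1 (ε₀ / 288) with hr
  have hr0 : 0 < r := lt_min one_pos (by positivity)
  obtain ⟨θ, hθ, hsmall⟩ := h.exists_slit_inter_subset_closedBall hr0
  refine ⟨θ, hθ, fun u hu huθ ↦ ?_⟩
  have hle := (h.isHydrodynamicMap_slitMap hu).hcap_le (hsmall hu huθ).1 hr0
  refine hle.trans ?_
  have hr1 : r ≤ 1 := min_le_left _ _
  have hrε : r ≤ ε₀ / 288 := min_le_right _ _
  nlinarith

/-- `b(u) ≥ 0`. [folklore] -/
theorem hcap_slit_nonneg (h : SlitArcData A γ) {u : ℝ} (hu : u ∈ Ioo (0 : ℝ) 1) :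
    0 ≤ hcap (slit γ u) (h.slitMap hu) :=
  (h.isHydrodynamicMap_slitMap hu).hcap_nonneg (h.isBounded_slit_inter hu.2)

/-- `b(u) > 0`. [cite: Lawler2005, §3.4 (3.8)] -/
theorem hcap_slit_pos (h : SlitArcData A γ) {u : ℝ} (hu : u ∈ Ioo (0 : ℝ) 1) :
    0 < hcap (slit γ u) (h.slitMap hu) :=
  (h.isPlusHull_slit hu).hcap_hydroMap_pos _

end SlitArcData

end Literature.Probability.RandomPlanarGeometry
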